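import Summits.NavierStokesRegularity.NavierStokesRegularity.Theses.PerpetualPump
import Summits.NavierStokesRegularity.NavierStokesRegularity.Theorems.CircuitPump.Negative.LoadBearing

/-!
# drefute probes for line `singular-clock-gspt` (crux `PerpetualPump.CircuitPump`, stmt-NavierStokesRegularity-1834)

Refuter `refuter-drefute-stmt-NavierStokesRegularity-1834-0`, 2026-08-16. Standalone, sorry-free. The `def`s below are
VERBATIM copies of the interface definitions of the LEAD'S RESHAPED `Cruxes/CircuitPump/Lines/singular-clock-gspt.lean`
(2026-08-16T03:48Z; over the landed `Theorems.CircuitPumpNegative.rhsF`) (`InBox`,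
`VanishesOutside`, `IsTruncSolOn`, `WBound`, `OnePeriodWitness`, `IsSolOn`, `BoxOK`, `WindowOK`, `CoveringHyp`), placed in the
sub-namespace `…SingularClockGspt.Drefute` so that this file elaborates on its own; every theorem transfers verbatim to the
skeleton's namespace (same texts). NO stub, NO skeleton theorem is restated here (this is not a line).

## Findings (all proved below)
* `exists_phaseMatched` — under `CoveringHyp`, every truncated solution on `[0,Tmax]` from a box state has a phase-matched
  flight time in its window (IVT on hypothesis (3)): hypothesis (2) is never vacuous once solutions exist.
* Degenerate data make `CoveringHyp` deny the existence of truncated solutions from (face) box states, hence — given the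
  truncated-flow existence theory that `CoveringPeriodicPoint` needs anyway — UNSATISFIABLE there:
  `coveringHyp_samePhase_noFaceSolution` (`ip = ia`), `coveringHyp_pointWindow_noSolution` (`lo ia = hi ia`),
  `coveringHyp_pointTime_noSolution` (`T₁ A = T₂ A`). Any `ClockBox` witness has `ip ≠ ia`, `lo ia < hi ia`, `T₁ < T₂`.
* `not_coveringHyp_zero_coeff` — THE ZERO CIRCUIT ADMITS NO CLOCK BOX, unconditionally (explicit free flow `freeTrunc`):
  `coeff = 0`, `BoxOK`, `WindowOK`, `L ≥ max L₀ 1` ⇒ `¬ CoveringHyp lam 0 …`. So `CoveringHyp` is not junk-satisfiable: the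
  scale-1 amplitude reading must be forced by `x_{ia,0}`.
* `not_onePeriodWitness_zero` — `m = 0` has no one-period witness (`DssExtension` vacuous there).
-/

set_option linter.dupNamespace false

noncomputable section

open Set
open scoped BigOperators

namespace Summit.NavierStokesRegularity.NavierStokesRegularity.Cruxes.CircuitPump.SingularClockGspt.Drefute

variable {m : ℕ}

/-! ## Interface definitions (verbatim from the skeleton) -/

/-- BOX MEMBERSHIP of a lattice state `x : Fin m → ℤ → ℝ`: at the ACTIVE scale `n = 0` a product of
intervals `[lo i, hi i]` (amplitude window, pinned/small phase, `c`- and `d`-corridors); at every other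
scale a compact convex SECTION `Q n ⊂ ℝ^m` (trail `n < 0`: frozen `b`, monotone `c`, and a DISC for the
rotor-turned remnant pair `(a,d)` — a product of intervals would lose a factor `√2` per period there;
precursors `n ≥ 1`: tiny balls). `Q 0` is ignored. -/
def InBox (lo hi : Fin m → ℝ) (Q : ℤ → Set (Fin m → ℝ)) (x : Fin m → ℤ → ℝ) : Prop :=
  (∀ i : Fin m, lo i ≤ x i 0 ∧ x i 0 ≤ hi i) ∧ ∀ n : ℤ, n ≠ 0 → (fun i => x i n) ∈ Q n

/-- The state vanishes at all scales `|n| > L` (finite truncation of the bi-infinite lattice). -/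
def VanishesOutside (L : ℕ) (x : Fin m → ℤ → ℝ) : Prop :=
  ∀ (i : Fin m) (n : ℤ), (L : ℤ) < |n| → x i n = 0

/-- `Z` solves the FULL lattice system on the closed window `[0, T]` (one-sided derivatives at the
two ends). -/
def IsSolOn (lam : ℝ) (coeff : Fin m → Fin m → Fin m → Option (Fin 3) → ℝ) (T : ℝ)
    (Z : Fin m → ℤ → ℝ → ℝ) : Prop :=
  ∀ (i : Fin m) (n : ℤ), ∀ t ∈ Icc (0 : ℝ) T,
    HasDerivWithinAt (Z i n) (Theorems.CircuitPumpNegative.rhsF lam coeff Z i n t) (Icc (0 : ℝ) T) t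

/-- `Z` is a solution on `[0, T]`, with datum `x`, of the lattice TRUNCATED to the scales `|n| ≤ L`:
modes outside are held at `0`; inside, the crux's equations hold with the outside modes read as `0`.
Truncation keeps cyclic cancellation triple by triple (a monomial whose partner equation is dropped
carries a vanishing outside factor), so the truncated system is a finite-dimensional polynomial ODE
whose quadratic part conserves `Σ X²` and whose linear part dissipates it: no blow-up, smooth flow. -/
def IsTruncSolOn (L : ℕ) (lam : ℝ) (coeff : Fin m → Fin m → Fin m → Option (Fin 3) → ℝ)
    (x : Fin m → ℤ → ℝ) (T : ℝ) (Z : Fin m → ℤ → ℝ → ℝ) : Prop :=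
  (∀ (i : Fin m) (n : ℤ), Z i n 0 = x i n) ∧
  (∀ (i : Fin m) (n : ℤ), (L : ℤ) < |n| → ∀ t ∈ Icc (0 : ℝ) T, Z i n t = 0) ∧
  (∀ (i : Fin m) (n : ℤ), |n| ≤ (L : ℤ) → ∀ t ∈ Icc (0 : ℝ) T,
      HasDerivWithinAt (Z i n) (Theorems.CircuitPumpNegative.rhsF lam coeff Z i n t) (Icc (0 : ℝ) T) t)

/-- The TYPE-I WEIGHTED sup bound `lam^{3n/5}|Z_{i,n}(t)| ≤ C` on the window `[0, T]` (the crux's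
Type-I weight at unit distance from the blow-up time; DSS propagates it to `C'/√(-t)`). Finite `C`
forces the trail (`n → -∞`, critical amplitude `O(1)`: weight `lam^{2n/5} → 0`) and kills nothing, and
forces the precursors (`n → +∞`) to be `O(lam^{-3n/5})`. -/
def WBound (lam C T : ℝ) (Z : Fin m → ℤ → ℝ → ℝ) : Prop :=
  ∀ (i : Fin m) (n : ℤ), ∀ t ∈ Icc (0 : ℝ) T, lam ^ ((3 / 5 : ℝ) * n) * |Z i n t| ≤ C

/-- A ONE-PERIOD WITNESS (relative periodic orbit of period `k = 1` modulo the scaling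
`S : X ↦ lam^{1/5} X_{·,n+1}(lam^{-4/5}·)`): a solution of the full lattice on a window `[0, T]`,
`T > 0`, whose final state is the up-shifted, down-scaled initial state,
`Z_{i,n+1}(T) = lam^{-1/5} Z_{i,n}(0)`, Type-I weighted bounded on the window, nonzero at time `0`. -/
def OnePeriodWitness (lam : ℝ) (m : ℕ) (coeff : Fin m → Fin m → Fin m → Option (Fin 3) → ℝ) :
    Prop :=
  ∃ T : ℝ, 0 < T ∧ ∃ Z : Fin m → ℤ → ℝ → ℝ, IsSolOn lam coeff T Z ∧
    (∀ (i : Fin m) (n : ℤ), Z i (n + 1) T = lam ^ (-(1 / 5 : ℝ)) * Z i n 0) ∧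
    (∃ C : ℝ, WBound lam C T Z) ∧ ∃ (i : Fin m) (n : ℤ), Z i n 0 ≠ 0

/-- The box data are sound: intervals at the active scale, compact convex nonempty sections elsewhere,
and OFF the active block `|n| ≤ L₀` every section contains `0` (so that truncated states — `x = 0` for
`|n| > L`, `L ≥ L₀` — are box states, and the finite slices of the box are nonempty compact convex). -/
def BoxOK (lo hi : Fin m → ℝ) (Q : ℤ → Set (Fin m → ℝ)) (L₀ : ℕ) : Prop :=
  (∀ i : Fin m, lo i ≤ hi i) ∧
  (∀ n : ℤ, n ≠ 0 → IsCompact (Q n) ∧ Convex ℝ (Q n) ∧ (Q n).Nonempty) ∧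
  (∀ n : ℤ, (L₀ : ℤ) < |n| → (fun _ : Fin m => (0 : ℝ)) ∈ Q n)

/-- The FLIGHT-TIME WINDOW `[T₁ A, T₂ A]`, a function of the amplitude coordinate `A ∈ [A₁, A₂]` (it
scales like the datum's own clock `τ_ν(A)/A`: "after the old scale's drain is complete, before the new
scale ignites"), is continuous, uniformly positive (`Tmin`), ordered, and inside the horizon `Tmax`. -/
def WindowOK (T₁ T₂ : ℝ → ℝ) (Tmin Tmax A₁ A₂ : ℝ) : Prop :=
  ContinuousOn T₁ (Icc A₁ A₂) ∧ ContinuousOn T₂ (Icc A₁ A₂) ∧ 0 < Tmin ∧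
    ∀ A ∈ Icc A₁ A₂, Tmin ≤ T₁ A ∧ T₁ A ≤ T₂ A ∧ T₂ A ≤ Tmax

/-- **THE A-PRIORI COVERING STRUCTURE of the renormalised one-period map at truncation level `L`**
(pure ODE estimates on solutions — no existence, no fixed-point theory). `ia` = the AMPLITUDE mode
(intended: Tao's `a`), `ip` = the PHASE mode (intended: Tao's fuse `b`; the phase functional is the
renormalised next-scale value `lam^{1/5} Z_{ip,1}(T)`, compared with the datum's own `x_{ip,0}`). For
every box state `x` vanishing off `|n| ≤ L`:
(0) A PRIORI BOUND: every truncated solution from `x` on any `[0, T'] ⊆ [0, Tmax]` obeys the weighted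
bound `C` (no box cascade outruns the clock before the horizon: the fastest box datum `A = 2A⋆` needs
`≈ t₀/(2.25ε₀) ≫ Tmax` to blow up);
and, for truncated solutions `Z` on `[0, Tmax]` and flight times `T` in the window of `A = x_{ia,0}`:
(1) INTO: the renormalised final state `(S⁻¹Z(T))_{·,n} = lam^{1/5} Z_{·,n+1}(T)` lies in the section
`Q n` for every `0 < |n| ≤ L`, and at the active scale its coordinates other than amplitude and phase lie
in their intervals (reset of `c`, `d`; frozen trail; slaved precursors; the clock law makes these
`o(1)`-statements, not `ε₀`-delicate ones);
(2) AMPLITUDE COVERING at PHASE-MATCHED times (`lam^{1/5} Z_{ip,1}(T) = x_{ip,0}`): the lower face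
`x_{ia,0} = lo ia` is mapped strictly below itself, the upper strictly above (the repelling fixed point of
the affine clock, `lower_face`/`upper_face` with allowance `(q-1)/4` against clock errors
`O(ε₀K^{-1/4})`);
(3) PHASE SIGNS: at the start of the window the phase functional is below `x_{ip,0}`, at the end above
(the next scale's fuse `b` grows through its pinned checkpoint value). -/
def CoveringHyp (lam : ℝ) (coeff : Fin m → Fin m → Fin m → Option (Fin 3) → ℝ)
    (lo hi : Fin m → ℝ) (Q : ℤ → Set (Fin m → ℝ)) (ia ip : Fin m) (T₁ T₂ : ℝ → ℝ) (C Tmax : ℝ)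
    (L : ℕ) : Prop :=
  ∀ x : Fin m → ℤ → ℝ, InBox lo hi Q x → VanishesOutside L x →
    (∀ (T' : ℝ) (Z : Fin m → ℤ → ℝ → ℝ), 0 < T' → T' ≤ Tmax →
        IsTruncSolOn L lam coeff x T' Z → WBound lam C T' Z) ∧
    (∀ Z : Fin m → ℤ → ℝ → ℝ, IsTruncSolOn L lam coeff x Tmax Z →
      (∀ T ∈ Icc (T₁ (x ia 0)) (T₂ (x ia 0)),
          (∀ n : ℤ, n ≠ 0 → |n| ≤ (L : ℤ) → (fun i => lam ^ (1 / 5 : ℝ) * Z i (n + 1) T) ∈ Q n) ∧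
          (∀ i : Fin m, i ≠ ia → i ≠ ip →
              lo i ≤ lam ^ (1 / 5 : ℝ) * Z i 1 T ∧ lam ^ (1 / 5 : ℝ) * Z i 1 T ≤ hi i)) ∧
      (∀ T ∈ Icc (T₁ (x ia 0)) (T₂ (x ia 0)), lam ^ (1 / 5 : ℝ) * Z ip 1 T = x ip 0 →
          (x ia 0 = lo ia → lam ^ (1 / 5 : ℝ) * Z ia 1 T < lo ia) ∧
          (x ia 0 = hi ia → hi ia < lam ^ (1 / 5 : ℝ) * Z ia 1 T)) ∧
      (lam ^ (1 / 5 : ℝ) * Z ip 1 (T₁ (x ia 0)) < x ip 0 ∧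
        x ip 0 < lam ^ (1 / 5 : ℝ) * Z ip 1 (T₂ (x ia 0))))


/-! ## DREFUTE PROBES (refuter-drefute-stmt-NavierStokesRegularity-1834-0, 2026-08-16)

Cheap structural facts about the stub interfaces (degenerate instances of `CoveringHyp`; `m = 0`). -/

section DrefuteProbes

variable {lam : ℝ} {coeff : Fin m → Fin m → Fin m → Option (Fin 3) → ℝ}
  {lo hi : Fin m → ℝ} {Q : ℤ → Set (Fin m → ℝ)} {ia ip : Fin m} {T₁ T₂ : ℝ → ℝ} {C Tmin Tmax : ℝ}
  {L : ℕ}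

/-- An in-range coordinate of a truncated solution is continuous on its window. -/
theorem continuousOn_of_isTruncSolOn {x : Fin m → ℤ → ℝ} {T : ℝ} {Z : Fin m → ℤ → ℝ → ℝ}
    (hZ : IsTruncSolOn L lam coeff x T Z) (i : Fin m) {n : ℤ} (hn : |n| ≤ (L : ℤ)) :
    ContinuousOn (Z i n) (Icc 0 T) := fun t ht =>
  (hZ.2.2 i n hn t ht).continuousWithinAt

/-- PHASE MATCHING EXISTS (IVT): under `CoveringHyp`, every truncated solution on `[0, Tmax]` from a box
state has a phase-matched flight time in its window (so hypothesis (2) is never vacuous once solutions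
exist). -/
theorem exists_phaseMatched (hcov : CoveringHyp lam coeff lo hi Q ia ip T₁ T₂ C Tmax L)
    (hwin : WindowOK T₁ T₂ Tmin Tmax (lo ia) (hi ia)) (hL : 1 ≤ L)
    {x : Fin m → ℤ → ℝ} (hx : InBox lo hi Q x) (hxL : VanishesOutside L x)
    {Z : Fin m → ℤ → ℝ → ℝ} (hZ : IsTruncSolOn L lam coeff x Tmax Z) :
    ∃ T ∈ Icc (T₁ (x ia 0)) (T₂ (x ia 0)), lam ^ (1 / 5 : ℝ) * Z ip 1 T = x ip 0 := by
  obtain ⟨-, h⟩ := hcov x hx hxL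
  obtain ⟨-, -, h3⟩ := h Z hZ
  obtain ⟨-, -, hTmin, hwinA⟩ := hwin
  obtain ⟨h1, h2, h3'⟩ := hwinA _ (hx.1 ia)
  have hsub : Icc (T₁ (x ia 0)) (T₂ (x ia 0)) ⊆ Icc 0 Tmax := Icc_subset_Icc (by linarith) h3'
  have h1L : |(1 : ℤ)| ≤ (L : ℤ) := by
    rw [abs_one]
    exact_mod_cast hL
  have hcont : ContinuousOn (fun T => lam ^ (1 / 5 : ℝ) * Z ip 1 T) (Icc (T₁ (x ia 0)) (T₂ (x ia 0))) :=
    continuousOn_const.mul ((continuousOn_of_isTruncSolOn hZ ip h1L).mono hsub)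
  have hivt := intermediate_value_Icc h2 hcont
  obtain ⟨T, hT, hTeq⟩ := hivt ⟨h3.1.le, h3.2.le⟩
  exact ⟨T, hT, hTeq⟩

/-- DEGENERATE INSTANCE 1 (`ip = ia`): if the phase mode IS the amplitude mode, `CoveringHyp` denies the
existence of any truncated solution on `[0, Tmax]` from a FACE box state (hypotheses (2) and (3) collide at the
phase-matched time). Since the truncated polynomial ODE with the a-priori bound (0) does have such solutions,
`CoveringHyp … ia ia …` is never satisfiable: any `ClockBox` instance has `ip ≠ ia`, and `CoveringPeriodicPoint`
is vacuous there (but discharging it formally still costs the existence theory). -/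
theorem coveringHyp_samePhase_noFaceSolution (hcov : CoveringHyp lam coeff lo hi Q ia ia T₁ T₂ C Tmax L)
    (hwin : WindowOK T₁ T₂ Tmin Tmax (lo ia) (hi ia)) (hL : 1 ≤ L)
    {x : Fin m → ℤ → ℝ} (hx : InBox lo hi Q x) (hxL : VanishesOutside L x)
    (hface : x ia 0 = lo ia ∨ x ia 0 = hi ia)
    {Z : Fin m → ℤ → ℝ → ℝ} (hZ : IsTruncSolOn L lam coeff x Tmax Z) : False := by
  obtain ⟨T, hT, hmatch⟩ := exists_phaseMatched hcov hwin hL hx hxL hZ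
  obtain ⟨-, h⟩ := hcov x hx hxL
  obtain ⟨-, h2, -⟩ := h Z hZ
  obtain ⟨hlo, hhi⟩ := h2 T hT hmatch
  rcases hface with hf | hf
  · have := hlo hf
    linarith
  · have := hhi hf
    linarith

/-- DEGENERATE INSTANCE 2 (`lo ia = hi ia`): a one-point amplitude window makes (2) self-contradictory at the
phase-matched time, so again no truncated solution on `[0, Tmax]` can exist from ANY box state: every `ClockBox`
instance has `lo ia < hi ia`. -/
theorem coveringHyp_pointWindow_noSolution (hcov : CoveringHyp lam coeff lo hi Q ia ip T₁ T₂ C Tmax L)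
    (hwin : WindowOK T₁ T₂ Tmin Tmax (lo ia) (hi ia)) (hL : 1 ≤ L) (hdeg : lo ia = hi ia)
    {x : Fin m → ℤ → ℝ} (hx : InBox lo hi Q x) (hxL : VanishesOutside L x)
    {Z : Fin m → ℤ → ℝ → ℝ} (hZ : IsTruncSolOn L lam coeff x Tmax Z) : False := by
  obtain ⟨T, hT, hmatch⟩ := exists_phaseMatched hcov hwin hL hx hxL hZ
  obtain ⟨-, h⟩ := hcov x hx hxL
  obtain ⟨-, h2, -⟩ := h Z hZ
  obtain ⟨hlo, hhi⟩ := h2 T hT hmatch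
  have hA := hx.1 ia
  have hf1 : x ia 0 = lo ia := le_antisymm (hdeg ▸ hA.2) hA.1
  have hf2 : x ia 0 = hi ia := hf1.trans hdeg
  have := hlo hf1
  have := hhi hf2
  linarith

/-- DEGENERATE INSTANCE 3 (`T₁ A = T₂ A`): a collapsed flight-time window at some box amplitude `A` makes (3)
self-contradictory: no truncated solution on `[0, Tmax]` from a box state with that amplitude. Every `ClockBox`
instance has `T₁ < T₂` on `[lo ia, hi ia]`. -/
theorem coveringHyp_pointTime_noSolution (hcov : CoveringHyp lam coeff lo hi Q ia ip T₁ T₂ C Tmax L)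
    {x : Fin m → ℤ → ℝ} (hx : InBox lo hi Q x) (hxL : VanishesOutside L x) (hdeg : T₁ (x ia 0) = T₂ (x ia 0))
    {Z : Fin m → ℤ → ℝ → ℝ} (hZ : IsTruncSolOn L lam coeff x Tmax Z) : False := by
  obtain ⟨-, h⟩ := hcov x hx hxL
  obtain ⟨-, -, h3⟩ := h Z hZ
  rw [hdeg] at h3
  linarith [h3.1, h3.2]

/-- `m = 0`: there is no one-period witness without modes (the `∃ i : Fin 0` clause), so `DssExtension` is
vacuous at `m = 0` and the composition's nontriviality really comes from `0 < lo ia`. -/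
theorem not_onePeriodWitness_zero (lam : ℝ) (coeff : Fin 0 → Fin 0 → Fin 0 → Option (Fin 3) → ℝ) :
    ¬ OnePeriodWitness lam 0 coeff := by
  rintro ⟨T, -, Z, -, -, -, i, -⟩
  exact i.elim0


/-! ### The zero circuit admits no clock box (unconditional small-model fact) -/

/-- The explicit truncated FREE flow (zero circuit): `Z_{i,n}(t) = x_{i,n} e^{-lam^{4n/5} t}` on `|n| ≤ L`, `0`
outside. -/
def freeTrunc (lam : ℝ) (L : ℕ) (x : Fin m → ℤ → ℝ) (i : Fin m) (n : ℤ) (t : ℝ) : ℝ :=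
  if |n| ≤ (L : ℤ) then x i n * Real.exp (-(lam ^ ((4 / 5 : ℝ) * n)) * t) else 0

theorem freeTrunc_of_le {lam : ℝ} {L : ℕ} {x : Fin m → ℤ → ℝ} {i : Fin m} {n : ℤ} (hn : |n| ≤ (L : ℤ))
    (t : ℝ) : freeTrunc lam L x i n t = x i n * Real.exp (-(lam ^ ((4 / 5 : ℝ) * n)) * t) := by
  unfold freeTrunc; rw [if_pos hn]

/-- For `coeff = 0` the crux right-hand side is the free decay. -/
theorem rhs_zero (lam : ℝ) (Z : Fin m → ℤ → ℝ → ℝ) (i : Fin m) (n : ℤ) (t : ℝ) :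
    Theorems.CircuitPumpNegative.rhsF lam 0 Z i n t = -(lam ^ ((4 / 5 : ℝ) * n)) * Z i n t := by
  simp [Theorems.CircuitPumpNegative.rhsF]

/-- The free flow is a truncated solution on every window, from every datum vanishing off `|n| ≤ L`. -/
theorem isTruncSolOn_freeTrunc (lam : ℝ) {L : ℕ} {x : Fin m → ℤ → ℝ} (hxL : VanishesOutside L x)
    (T : ℝ) : IsTruncSolOn L lam 0 x T (freeTrunc lam L x) := by
  refine ⟨?_, ?_, ?_⟩
  · intro i n
    unfold freeTrunc
    split_ifs with h
    · simp
    · exact (hxL i n (not_le.mp h)).symm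
  · intro i n hn t _
    unfold freeTrunc
    rw [if_neg (not_le.mpr hn)]
  · intro i n hn t _
    have hfun : freeTrunc lam L x i n =
        fun s => x i n * Real.exp (-(lam ^ ((4 / 5 : ℝ) * n)) * s) := by
      funext s
      exact freeTrunc_of_le hn s
    rw [rhs_zero, hfun]
    have h := ((((hasDerivAt_id t).const_mul (-(lam ^ ((4 / 5 : ℝ) * (n : ℝ))))).exp).const_mul
      (x i n)).hasDerivWithinAt (s := Icc 0 T)
    refine h.congr_deriv ?_
    simp only [id]
    ring

/-- **THE ZERO CIRCUIT ADMITS NO CLOCK BOX.** For `coeff = 0`, sound box data (`BoxOK`), a sound window and any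
truncation level `L ≥ max L₀ 1`, the covering structure `CoveringHyp` FAILS — unconditionally, because the free flow
is explicit. Mechanism: the phase-matched time is pinned by `(x_{ip,0}, x_{ip,1})` alone, and the amplitude reading
`lam^{1/5} Z_{ia,1}(T)` by `x_{ia,1}` and `T` alone, while hypothesis (2) would have to separate two box states that
differ ONLY in `x_{ia,0}` (lower face vs upper face). So `CoveringHyp` is not junk-satisfiable by the trivial circuit:
any `ClockBox` instance is genuinely nonlinear, with the amplitude at scale `1` FORCED by scale `0`. -/
theorem not_coveringHyp_zero_coeff {L₀ : ℕ} (hlam : 0 < lam) (hbox : BoxOK lo hi Q L₀) (hL₀ : L₀ ≤ L)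
    (hL : 1 ≤ L) (hwin : WindowOK T₁ T₂ Tmin Tmax (lo ia) (hi ia)) :
    ¬ CoveringHyp lam 0 lo hi Q ia ip T₁ T₂ C Tmax L := by
  intro hcov
  classical
  have hne : ∀ n : ℤ, n ≠ 0 → (Q n).Nonempty := fun n hn => (hbox.2.1 n hn).2.2
  -- base environment: a point of each section on the active block, zero beyond it
  let y : ℤ → Fin m → ℝ := fun n =>
    if h : n ≠ 0 ∧ |n| ≤ (L₀ : ℤ) then (hne n h.1).some else fun _ => 0
  have hyQ : ∀ n : ℤ, n ≠ 0 → y n ∈ Q n := by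
    intro n hn
    by_cases h : |n| ≤ (L₀ : ℤ)
    · simp only [y, dif_pos (And.intro hn h)]
      exact (hne n hn).some_mem
    · simp only [y, dif_neg (show ¬ (n ≠ 0 ∧ |n| ≤ (L₀ : ℤ)) by tauto)]
      exact hbox.2.2 n (not_le.mp h)
  -- the one-parameter family of box states differing only in the amplitude coordinate
  let xA : ℝ → Fin m → ℤ → ℝ := fun A i n => if n = 0 then (if i = ia then A else lo i) else y n i
  have hx0 : ∀ A, xA A ia 0 = A := fun A => by simp [xA]
  have hx1 : ∀ A (i : Fin m), xA A i 1 = y 1 i := fun A i => by simp [xA]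
  have hInBox : ∀ A ∈ Icc (lo ia) (hi ia), InBox lo hi Q (xA A) := by
    intro A hA
    refine ⟨fun i => ?_, fun n hn => ?_⟩
    · by_cases hi' : i = ia
      · subst hi'
        simp [xA, hA.1, hA.2]
      · simp [xA, hi', hbox.1 i]
    · simp only [xA, if_neg hn]
      exact hyQ n hn
  have hVan : ∀ A, VanishesOutside L (xA A) := by
    intro A i n hn
    have hn0 : n ≠ 0 := by
      rintro rfl
      simp at hn
      omega
    have hnL₀ : ¬ (n ≠ 0 ∧ |n| ≤ (L₀ : ℤ)) := by
      omega
    simp only [xA, if_neg hn0, y, dif_neg hnL₀]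
  have h1L : |(1 : ℤ)| ≤ (L : ℤ) := by
    rw [abs_one]
    exact_mod_cast hL
  have hlo_mem : lo ia ∈ Icc (lo ia) (hi ia) := ⟨le_rfl, hbox.1 ia⟩
  have hhi_mem : hi ia ∈ Icc (lo ia) (hi ia) := ⟨hbox.1 ia, le_rfl⟩
  by_cases hip : ip = ia
  · subst hip
    exact coveringHyp_samePhase_noFaceSolution hcov hwin hL (hInBox _ hlo_mem) (hVan _)
      (Or.inl (hx0 _)) (isTruncSolOn_freeTrunc lam (hVan _) Tmax)
  · have hxp : ∀ A, xA A ip 0 = lo ip := fun A => by simp [xA, hip]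
    -- phase-matched times for the two face states
    obtain ⟨Tl, hTl, hml⟩ := exists_phaseMatched hcov hwin hL (hInBox _ hlo_mem) (hVan _)
      (isTruncSolOn_freeTrunc lam (hVan (lo ia)) Tmax)
    obtain ⟨Th, hTh, hmh⟩ := exists_phaseMatched hcov hwin hL (hInBox _ hhi_mem) (hVan _)
      (isTruncSolOn_freeTrunc lam (hVan (hi ia)) Tmax)
    rw [freeTrunc_of_le h1L, hx1, hxp] at hml hmh
    -- covering data for the two states
    obtain ⟨-, hl⟩ := hcov (xA (lo ia)) (hInBox _ hlo_mem) (hVan _)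
    obtain ⟨-, h2l, h3l⟩ := hl _ (isTruncSolOn_freeTrunc lam (hVan (lo ia)) Tmax)
    obtain ⟨-, hh⟩ := hcov (xA (hi ia)) (hInBox _ hhi_mem) (hVan _)
    obtain ⟨-, h2h, -⟩ := hh _ (isTruncSolOn_freeTrunc lam (hVan (hi ia)) Tmax)
    by_cases hy : y 1 ip = 0
    · -- phase functional identically zero: (3) reads 0 < lo ip < 0
      rw [freeTrunc_of_le h1L, freeTrunc_of_le h1L, hx1, hxp, hy] at h3l
      simp at h3l
      linarith [h3l.1, h3l.2]
    · have hq : 0 < lam ^ (1 / 5 : ℝ) := Real.rpow_pos_of_pos hlam _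
      -- the two phase-matched exponentials agree
      have hexp : Real.exp (-lam ^ ((4 / 5 : ℝ) * ((1 : ℤ) : ℝ)) * Tl) =
          Real.exp (-lam ^ ((4 / 5 : ℝ) * ((1 : ℤ) : ℝ)) * Th) := by
        have hq0 : lam ^ (1 / 5 : ℝ) * y 1 ip ≠ 0 := mul_ne_zero hq.ne' hy
        have := hml.trans hmh.symm
        have : lam ^ (1 / 5 : ℝ) * y 1 ip * Real.exp (-lam ^ ((4 / 5 : ℝ) * ((1 : ℤ) : ℝ)) * Tl) =
            lam ^ (1 / 5 : ℝ) * y 1 ip * Real.exp (-lam ^ ((4 / 5 : ℝ) * ((1 : ℤ) : ℝ)) * Th) := by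
          rw [mul_assoc, mul_assoc]; exact this
        exact mul_left_cancel₀ hq0 this
      -- amplitude readings at the two faces coincide, but (2) separates them strictly
      have h2l' := (h2l Tl hTl (by rw [freeTrunc_of_le h1L, hx1, hxp]; exact hml)).1 (hx0 _)
      have h2h' := (h2h Th hTh (by rw [freeTrunc_of_le h1L, hx1, hxp]; exact hmh)).2 (hx0 _)
      rw [freeTrunc_of_le h1L, hx1] at h2l' h2h'
      rw [hexp] at h2l'
      have := hbox.1 ia
      linarith

end DrefuteProbes

end Summit.NavierStokesRegularity.NavierStokesRegularity.Cruxes.CircuitPump.SingularClockGspt.Drefute
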